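import Mathlib
import Literature.Analysis.FluidPDE.VectorCalculus
import Literature.Analysis.FluidPDE.TaoAveragedNondegeneracy
import Summits.NavierStokesRegularity.NavierStokesRegularity.Theorems.FilamentSkeletonRssSkeletonEquilibriumStraightSkeletonSlip

/-!
# Horizontal confinement of vertical-line skeletons; the `K ≤ 0` slice of `stub_outerShadowing`
(helper for the registered stub `stub_outerShadowing` of crux `FilamentSkeletonRss.SkeletonEquilibrium`,
stmt-NavierStokesRegularity-15400; negation line `mirror-point-negation` (s2); companion of
`…StraightFilamentRigidity` / `…StraightSkeletonStrain`, the `K ≤ 0` slices of the s1 stubs)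

For `K ≤ 0` every witness of the crux's clauses is a configuration of vertical straight lines
`Ξ k σ = a_k + σ e_k`, `e₃ × e_k = 0` (`StraightFilament.vertical_lines_of_nonposK`). Two more facts close
the s2 stub `stub_outerShadowing` in this class:
* `norm_perp_le_two_mul_norm` — HORIZONTAL CONFINEMENT: pairing the tangency relation at a point `x` of a
  vertical line with `x⊥ = x − ⟪x, e_k⟫e_k` gives `½‖x⊥‖² = −⟪u(x), x⊥⟫`, so `‖x⊥‖ ≤ 2‖u(x)‖`;
* `norm_skeletonVelocity_le_sqrt` — along filament `k` of a straight `ρ√Γ`-separated skeleton the induced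
  velocity is `≤ √Γ · Σ_k' |γ_k'|/(2πρ)` (each other line contributes `(Γ|γ|/4π)·2d/(d²+1) ≤ (Γ|γ|/4π)·2/(ρ√Γ)`
  at distance `d ≥ ρ√Γ`, the own line nothing — re-based closed form `lineBiotSavart_rebase`).
Hence every line sits at horizontal distance `≤ √Γ Σ|γ|/(πρ) = o(√(Γ log Γ))` from the axis, and with the
exact profile solution `Yo(s) = s e_k` (a vertical unit-speed line through the origin solves
`Yo″ = (4π/γ_k) Yo′ × (½Yo − α e₃ × Yo)`) both shadowing clauses of the stub hold for
`Γ ≥ Γ₁ = max 2 (exp (8C₁²/ε²))`, `C₁ = Σ|γ|/(2πρ)`: `outerShadowing_of_nonposK` is the registered statement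
with the single extra hypothesis `K ≤ 0` (inserted after `0 < C₀`). No summit statement is proved; NS
regularity is not touched.
-/

noncomputable section

open Set Filter Topology MeasureTheory
open Literature.Analysis.FluidPDE Literature.Analysis.FluidPDE.Tao2016
open scoped RealInnerProductSpace InnerProductSpace

namespace Summit.NavierStokesRegularity.NavierStokesRegularity.Theorems.SkeletonEquilibrium.StraightFilament
set_option linter.dupNamespace false

/-- `‖v × w‖ ≤ ‖v‖ ‖w‖`. [folklore] -/
private theorem norm_cross_le'' (v w : EuclideanSpace ℝ (Fin 3)) : ‖cross v w‖ ≤ ‖v‖ * ‖w‖ := by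
  rw [norm_cross]
  exact mul_le_of_le_one_right (mul_nonneg (norm_nonneg _) (norm_nonneg _)) (Real.sin_le_one _)

/-- Triple-product swap `⟪u × v, w⟫ = −⟪u × w, v⟫` (coordinates). [folklore] -/
private theorem inner_cross_swap' (u v w : EuclideanSpace ℝ (Fin 3)) :
    ⟪cross u v, w⟫ = -⟪cross u w, v⟫ := by
  simp only [real_inner_fin3, cross_apply_zero, cross_apply_one, cross_apply_two]
  ring

/-! ## Horizontal confinement -/

/-- **Horizontal confinement.** If `u + ½x − α e₃×x = w • e` with `‖e‖ = 1` and `e₃ × e = 0` (a point of a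
VERTICAL line of a relative equilibrium), then the component of `x` orthogonal to `e` has norm
`≤ 2‖u‖` (pair with `x − ⟪x,e⟫e`: the rotation and the slip drop out). [folklore] -/
theorem norm_perp_le_two_mul_norm {x e u : EuclideanSpace ℝ (Fin 3)} {α w : ℝ} (he : ‖e‖ = 1)
    (hv : cross (EuclideanSpace.single (2 : Fin 3) (1 : ℝ)) e = 0)
    (heq : u + (1 / 2 : ℝ) • x - α • cross (EuclideanSpace.single (2 : Fin 3) (1 : ℝ)) x = w • e) :
    ‖x - ⟪x, e⟫ • e‖ ≤ 2 * ‖u‖ := by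
  set p := x - ⟪x, e⟫ • e with hp
  have hee : ⟪e, e⟫ = 1 := by rw [real_inner_self_eq_norm_sq, he]; norm_num
  have hep : ⟪e, p⟫ = 0 := by
    rw [hp, inner_sub_right, real_inner_smul_right, hee, real_inner_comm]; ring
  have hxp : ⟪x, p⟫ = ‖p‖ ^ 2 := by
    have h1 : ⟪x, p⟫ = ‖x‖ ^ 2 - ⟪x, e⟫ ^ 2 := by
      rw [hp, inner_sub_right, real_inner_smul_right, real_inner_self_eq_norm_sq]; ring
    have h2 : ‖p‖ ^ 2 = ‖x‖ ^ 2 - ⟪x, e⟫ ^ 2 := by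
      rw [← real_inner_self_eq_norm_sq, hp, inner_sub_left, inner_sub_right, inner_sub_right,
        real_inner_smul_left, real_inner_smul_right, real_inner_smul_left, real_inner_smul_right,
        real_inner_self_eq_norm_sq, hee, real_inner_comm e x]
      ring
    rw [h1, h2]
  have hrot : ⟪cross (EuclideanSpace.single (2 : Fin 3) (1 : ℝ)) x, p⟫ = 0 := by
    rw [hp, inner_sub_right, real_inner_smul_right, inner_cross_self_right,
      inner_cross_swap' _ x e, hv, inner_zero_left, neg_zero, mul_zero, sub_zero]
  have h := congrArg (fun v => ⟪v, p⟫) heq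
  simp only [inner_add_left, inner_sub_left, real_inner_smul_left, hxp, hrot, hep, mul_zero,
    sub_zero] at h
  -- `⟪u, p⟫ + ½‖p‖² = 0`
  have hcs : -⟪u, p⟫ ≤ ‖u‖ * ‖p‖ := by
    have := abs_real_inner_le_norm u p
    rw [abs_le] at this
    linarith [this.1]
  have hsq : ‖p‖ ^ 2 ≤ 2 * ‖u‖ * ‖p‖ := by nlinarith
  rcases eq_or_lt_of_le (norm_nonneg p) with hp0 | hp0
  · rw [← hp0]; positivity
  · nlinarith

/-! ## Velocity bound along a filament of a separated straight skeleton -/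

/-- **Induced velocity along a filament of a separated straight skeleton.** For unit-speed straight lines
`Ξ k σ = a k + σ • e k` with `ρ√Γ`-separation, at the point `x = Ξ j τ` of line `j` the skeleton velocity
is `≤ √Γ · Σ_k |γ_k| / (2πρ)` (the own line contributes nothing; line `k ≠ j` at distance `d ≥ ρ√Γ`
contributes `(Γ|γ_k|/4π)·2d/(d²+1) ≤ (Γ|γ_k|/4π)·2/(ρ√Γ)`). [folklore] -/
theorem norm_skeletonVelocity_le_sqrt {N : ℕ} {Γ ρ : ℝ} (hΓ : 0 < Γ) (hρ : 0 < ρ) (γ : Fin N → ℝ)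
    {Ξ : Fin N → ℝ → EuclideanSpace ℝ (Fin 3)} (a e : Fin N → EuclideanSpace ℝ (Fin 3))
    (he : ∀ k, ‖e k‖ = 1) (hline : ∀ k σ, Ξ k σ = a k + σ • e k) (hder : ∀ k σ, deriv (Ξ k) σ = e k)
    (hsep : ∀ j k, j ≠ k → ∀ τ σ, ρ * Real.sqrt Γ ≤ ‖Ξ j τ - Ξ k σ‖) (j : Fin N) (τ : ℝ) :
    ‖∑ k : Fin N, (Γ * γ k / (4 * Real.pi)) • ∫ σ : ℝ,
        ((‖Ξ j τ - Ξ k σ‖ ^ 2 + 1) ^ (3 / 2 : ℝ))⁻¹ • cross (deriv (Ξ k) σ) (Ξ j τ - Ξ k σ)‖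
      ≤ Real.sqrt Γ * (∑ k : Fin N, |γ k| / (2 * Real.pi * ρ)) := by
  have hsq : 0 < Real.sqrt Γ := Real.sqrt_pos.2 hΓ
  set x := Ξ j τ with hx
  -- per-line bound
  have hk : ∀ k, ‖(Γ * γ k / (4 * Real.pi)) • ∫ σ : ℝ,
      ((‖x - Ξ k σ‖ ^ 2 + 1) ^ (3 / 2 : ℝ))⁻¹ • cross (deriv (Ξ k) σ) (x - Ξ k σ)‖
        ≤ Real.sqrt Γ * (|γ k| / (2 * Real.pi * ρ)) := by
    intro k
    set s : ℝ := ⟪x - a k, e k⟫ with hs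
    set q : EuclideanSpace ℝ (Fin 3) := x - (a k + s • e k) with hq
    have hqe : ⟪q, e k⟫ = 0 := inner_foot_eq_zero (a k) (e k) x (he k)
    have hclosed : (∫ σ : ℝ, ((‖x - Ξ k σ‖ ^ 2 + 1) ^ (3 / 2 : ℝ))⁻¹ •
        cross (deriv (Ξ k) σ) (x - Ξ k σ)) = (2 / (‖q‖ ^ 2 + 1)) • cross (e k) q := by
      simp_rw [hder k, hline k]
      rw [lineBiotSavart_rebase (a k) (e k) x s (he k), ← hq, hqe]
      simp
    rw [hclosed, norm_smul, norm_smul, Real.norm_eq_abs, Real.norm_eq_abs, abs_div, abs_mul,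
      abs_of_pos hΓ, abs_of_pos (by positivity : (0 : ℝ) < 4 * Real.pi),
      abs_of_pos (by positivity : (0 : ℝ) < 2 / (‖q‖ ^ 2 + 1))]
    have hcq : ‖cross (e k) q‖ ≤ ‖q‖ := by
      have := norm_cross_le'' (e k) q; rwa [he k, one_mul] at this
    by_cases hkj : k = j
    · -- own line: `q = 0`
      have hq0 : q = 0 := by
        have h1 : s = τ := by
          rw [hs, hx, hline j τ, hkj, add_sub_cancel_left, real_inner_smul_left,
            real_inner_self_eq_norm_sq, he j]
          ring
        rw [hq, h1, hx, hline j τ, hkj, sub_self]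
      rw [hq0]
      have h0 : cross (e k) (0 : EuclideanSpace ℝ (Fin 3)) = 0 := by
        rw [← crossCLM_apply]; exact (crossCLM (e k)).map_zero
      rw [h0, norm_zero, mul_zero, mul_zero]
      positivity
    · -- another line: distance `‖q‖ ≥ ρ√Γ`
      have hd : ρ * Real.sqrt Γ ≤ ‖q‖ := by
        have h := hsep j k (Ne.symm hkj) τ s
        rwa [← hx, hline k s, ← hq] at h
      have hqpos : 0 < ‖q‖ := lt_of_lt_of_le (by positivity) hd
      have h1 : 2 / (‖q‖ ^ 2 + 1) * ‖cross (e k) q‖ ≤ 2 / (ρ * Real.sqrt Γ) := by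
        calc 2 / (‖q‖ ^ 2 + 1) * ‖cross (e k) q‖ ≤ 2 / (‖q‖ ^ 2 + 1) * ‖q‖ := by gcongr
          _ ≤ 2 / ‖q‖ := by
              rw [div_mul_eq_mul_div, div_le_div_iff₀ (by positivity) hqpos]
              nlinarith [sq_nonneg ‖q‖]
          _ ≤ 2 / (ρ * Real.sqrt Γ) := div_le_div_of_nonneg_left (by norm_num) (by positivity) hd
      calc Γ * |γ k| / (4 * Real.pi) * (2 / (‖q‖ ^ 2 + 1) * ‖cross (e k) q‖)
          ≤ Γ * |γ k| / (4 * Real.pi) * (2 / (ρ * Real.sqrt Γ)) :=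
            mul_le_mul_of_nonneg_left h1 (by positivity)
        _ = Real.sqrt Γ * (|γ k| / (2 * Real.pi * ρ)) := by
            have hc : Γ * |γ k| / (4 * Real.pi) = Real.sqrt Γ ^ 2 * |γ k| / (4 * Real.pi) := by
              rw [Real.sq_sqrt hΓ.le]
            have hsqne : Real.sqrt Γ ≠ 0 := hsq.ne'
            rw [hc]
            field_simp
            ring
  calc ‖∑ k : Fin N, (Γ * γ k / (4 * Real.pi)) • ∫ σ : ℝ,
          ((‖x - Ξ k σ‖ ^ 2 + 1) ^ (3 / 2 : ℝ))⁻¹ • cross (deriv (Ξ k) σ) (x - Ξ k σ)‖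
      ≤ ∑ k : Fin N, ‖(Γ * γ k / (4 * Real.pi)) • ∫ σ : ℝ,
          ((‖x - Ξ k σ‖ ^ 2 + 1) ^ (3 / 2 : ℝ))⁻¹ • cross (deriv (Ξ k) σ) (x - Ξ k σ)‖ :=
        norm_sum_le _ _
    _ ≤ ∑ k : Fin N, Real.sqrt Γ * (|γ k| / (2 * Real.pi * ρ)) := Finset.sum_le_sum fun k _ => hk k
    _ = Real.sqrt Γ * (∑ k : Fin N, |γ k| / (2 * Real.pi * ρ)) := by rw [Finset.mul_sum]

/-! ## The registered stub `stub_outerShadowing`, `K ≤ 0` slice -/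

/-- **`stub_outerShadowing`, `K ≤ 0` slice.** The registered statement of `stub_outerShadowing` with the
single extra hypothesis `K ≤ 0` (inserted after `0 < C₀`): for `Γ ≥ Γ₁ = max 2 (exp (8C₁²/ε²))`,
`C₁ = Σ_k |γ_k|/(2πρ)`, every filament is a vertical line at horizontal distance `≤ 2C₁√Γ` from the axis,
and the exact profile solution `Yo(s) = s • Ξ k′(0)` (the oriented axis) shadows it: tangents agree
exactly, and in the outer variable `(√(Γ log Γ/2))⁻¹ Ξ k` the offset is `≤ 2C₁/√(log Γ/2) ≤ ε`. The
separation clause is used (for the velocity bound); integrability, length-regularity and `γ_j ≠ 0` are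
idle. [folklore] -/
theorem outerShadowing_of_nonposK :
    ∀ (N : ℕ) (γ : Fin N → ℝ) (α ρ K C₀ : ℝ), α ≠ 0 → 0 < ρ → 0 < C₀ → K ≤ 0 → (∀ j, γ j ≠ 0) →
      ∀ ε : ℝ, 0 < ε → ∀ R₁ R₃ R : ℝ, 0 < R₁ → R₁ ≤ R₃ → 0 ≤ R → ∃ Γ₁ : ℝ, ∀ Γ : ℝ, Γ₁ ≤ Γ → 1 ≤ Γ →
        ∀ (Ξ : Fin N → ℝ → EuclideanSpace ℝ (Fin 3)) (w : Fin N → ℝ → ℝ),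
          (∀ j, ContDiff ℝ 2 (Ξ j) ∧ Function.Injective (Ξ j) ∧ Differentiable ℝ (w j) ∧
              (∀ τ, ‖deriv (Ξ j) τ‖ = 1) ∧ (∀ τ, ‖iteratedDeriv 2 (Ξ j) τ‖ * Real.sqrt Γ ≤ K) ∧
              Tendsto (fun τ => ‖Ξ j τ‖) atTop atTop ∧ Tendsto (fun τ => ‖Ξ j τ‖) atBot atTop) →
          (∀ j k, j ≠ k → ∀ τ σ, ρ * Real.sqrt Γ ≤ ‖Ξ j τ - Ξ k σ‖) →
          (∀ j (x : EuclideanSpace ℝ (Fin 3)), Integrable (fun σ : ℝ =>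
              ((‖x - Ξ j σ‖ ^ 2 + 1) ^ (3 / 2 : ℝ))⁻¹ • cross (deriv (Ξ j) σ) (x - Ξ j σ))) →
          (∀ j τ, (∑ k : Fin N, (Γ * γ k / (4 * Real.pi)) • ∫ σ : ℝ,
                ((‖Ξ j τ - Ξ k σ‖ ^ 2 + 1) ^ (3 / 2 : ℝ))⁻¹ • cross (deriv (Ξ k) σ) (Ξ j τ - Ξ k σ))
              + (1 / 2 : ℝ) • Ξ j τ - α • cross (EuclideanSpace.single (2 : Fin 3) (1 : ℝ)) (Ξ j τ)
              = w j τ • deriv (Ξ j) τ) →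
          (∀ (k : Fin N) (x : EuclideanSpace ℝ (Fin 3)) (D : ℝ), Real.sqrt Γ ≤ D →
              volume {τ : ℝ | ‖Ξ k τ - x‖ ≤ D} ≤ ENNReal.ofReal (C₀ * D)) →
          ∀ k : Fin N, ∃ Yo : ℝ → EuclideanSpace ℝ (Fin 3), ContDiff ℝ 2 Yo ∧ (∀ s, ‖deriv Yo s‖ = 1) ∧
            (∀ s, iteratedDeriv 2 Yo s = (4 * Real.pi / γ k) •
              cross (deriv Yo s) ((1 / 2 : ℝ) • Yo s
                - α • cross (EuclideanSpace.single (2 : Fin 3) (1 : ℝ)) (Yo s))) ∧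
            (∀ τ, ‖Ξ k τ‖ ≤ Real.sqrt (Γ * Real.log Γ / 2) + R * Real.sqrt Γ →
              ∃ s, ‖Yo s‖ ≤ 2 ∧ ‖deriv (Ξ k) τ - deriv Yo s‖ ≤ ε) ∧
            (∀ s, R₁ ≤ ‖Yo s‖ → ‖Yo s‖ ≤ R₃ →
              ∃ τ, ‖(Real.sqrt (Γ * Real.log Γ / 2))⁻¹ • Ξ k τ - Yo s‖ ≤ ε ∧
                ‖deriv (Ξ k) τ - deriv Yo s‖ ≤ ε) := by
  intro N γ α ρ K C₀ hα hρ _ hK _ ε hε R₁ R₃ R _ _ _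
  set C₁ : ℝ := ∑ k : Fin N, |γ k| / (2 * Real.pi * ρ) with hC₁
  have hC₁0 : 0 ≤ C₁ := Finset.sum_nonneg fun k _ => by positivity
  refine ⟨max 2 (Real.exp (8 * C₁ ^ 2 / ε ^ 2)), ?_⟩
  intro Γ hΓ₁ hΓ1 Ξ w hcl hsep _ heq _ k
  have hΓ2 : 2 ≤ Γ := le_trans (le_max_left _ _) hΓ₁
  have hΓexp : Real.exp (8 * C₁ ^ 2 / ε ^ 2) ≤ Γ := le_trans (le_max_right _ _) hΓ₁
  have hΓ0 : 0 < Γ := by linarith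
  have hsq : 0 < Real.sqrt Γ := Real.sqrt_pos.2 hΓ0
  have hlog : 8 * C₁ ^ 2 / ε ^ 2 ≤ Real.log Γ := by
    rw [Real.le_log_iff_exp_le hΓ0]; exact hΓexp
  have hlogpos : 0 < Real.log Γ := Real.log_pos (by linarith)
  -- the configuration is a family of vertical lines
  have hvl := vertical_lines_of_nonposK (γ := γ) hα hK hΓ1 hcl heq
  have he' : ∀ k', ‖deriv (Ξ k') 0‖ = 1 := fun k' => (hvl k').2.2.1
  have hline' : ∀ k' σ, Ξ k' σ = Ξ k' 0 + σ • deriv (Ξ k') 0 := fun k' σ => (hvl k').2.1 σ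
  have hder' : ∀ k' σ, deriv (Ξ k') σ = deriv (Ξ k') 0 := fun k' σ => (hvl k').1 σ
  set e : EuclideanSpace ℝ (Fin 3) := deriv (Ξ k) 0 with hedef
  have he : ‖e‖ = 1 := he' k
  have hv : cross (EuclideanSpace.single (2 : Fin 3) (1 : ℝ)) e = 0 := (hvl k).2.2.2
  -- horizontal confinement of line `k`: `‖(Ξ k 0)⊥‖ ≤ 2 ‖u(Ξ k 0)‖ ≤ 2 √Γ C₁`
  have hU := norm_skeletonVelocity_le_sqrt hΓ0 hρ γ (fun k' => Ξ k' 0) (fun k' => deriv (Ξ k') 0)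
    he' hline' hder' hsep k 0
  have hconf := norm_perp_le_two_mul_norm he hv (heq k 0)
  have hperp : ‖Ξ k 0 - ⟪Ξ k 0, e⟫ • e‖ ≤ 2 * (Real.sqrt Γ * C₁) :=
    hconf.trans (mul_le_mul_of_nonneg_left hU (by norm_num))
  -- the profile solution `Yo s = s • e`
  have hYo' : ∀ s : ℝ, deriv (fun s : ℝ => s • e) s = e := fun s => by
    have h := ((hasDerivAt_id s).smul_const e).deriv
    simpa using h
  refine ⟨fun s => s • e, contDiff_id.smul contDiff_const, fun s => by rw [hYo' s, he], ?_, ?_, ?_⟩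
  · intro s
    have hY2 : iteratedDeriv 2 (fun s : ℝ => s • e) s = 0 := by
      rw [iteratedDeriv_succ, iteratedDeriv_one, show deriv (fun s : ℝ => s • e) = fun _ => e from
        funext hYo', deriv_const]
    rw [hY2, hYo' s]
    simp only [cross_smul_right, hv, smul_zero, sub_zero, cross_self_eq_zero]
  · intro τ _
    refine ⟨0, ?_, ?_⟩
    · simp only [zero_smul, norm_zero]
      norm_num
    · rw [hder' k τ, hYo' 0, ← hedef, sub_self, norm_zero]
      exact hε.le
  · intro s _ _
    set L : ℝ := Real.sqrt (Γ * Real.log Γ / 2) with hL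
    have hL' : L = Real.sqrt Γ * Real.sqrt (Real.log Γ / 2) := by
      rw [hL, show Γ * Real.log Γ / 2 = Γ * (Real.log Γ / 2) by ring, Real.sqrt_mul hΓ0.le]
    have hLpos : 0 < L := by
      rw [hL]; exact Real.sqrt_pos.2 (div_pos (mul_pos hΓ0 hlogpos) two_pos)
    refine ⟨L * s - ⟪Ξ k 0, e⟫, ?_, ?_⟩
    · rw [hline' k (L * s - ⟪Ξ k 0, e⟫), ← hedef]
      have hid : L⁻¹ • (Ξ k 0 + (L * s - ⟪Ξ k 0, e⟫) • e) - s • e = L⁻¹ • (Ξ k 0 - ⟪Ξ k 0, e⟫ • e) := by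
        ext i
        simp only [PiLp.sub_apply, PiLp.add_apply, PiLp.smul_apply, smul_eq_mul]
        field_simp
        ring
      rw [hid, norm_smul, Real.norm_eq_abs, abs_of_pos (inv_pos.2 hLpos), inv_mul_le_iff₀ hLpos]
      have hkey : 2 * C₁ / ε ≤ Real.sqrt (Real.log Γ / 2) := by
        rw [show 2 * C₁ / ε = Real.sqrt ((2 * C₁ / ε) ^ 2) by rw [Real.sqrt_sq (by positivity)]]
        apply Real.sqrt_le_sqrt
        rw [show (2 * C₁ / ε) ^ 2 = (8 * C₁ ^ 2 / ε ^ 2) / 2 by ring]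
        linarith
      calc ‖Ξ k 0 - ⟪Ξ k 0, e⟫ • e‖ ≤ 2 * (Real.sqrt Γ * C₁) := hperp
        _ = Real.sqrt Γ * (2 * C₁ / ε) * ε := by field_simp
        _ ≤ Real.sqrt Γ * Real.sqrt (Real.log Γ / 2) * ε := by gcongr
        _ = L * ε := by rw [hL']
    · rw [hder' k, hYo' s, ← hedef, sub_self, norm_zero]
      exact hε.le

end Summit.NavierStokesRegularity.NavierStokesRegularity.Theorems.SkeletonEquilibrium.StraightFilament
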